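import Summits.SmoothPoincare4.SmoothPoincare4.Theses.EntropyRung
import Summits.SmoothPoincare4.SmoothPoincare4.Theorems.EntropyRungSubcylindricalExistenceCapFactor
import Literature.Geometry.Lorentzian.DalembertianCompose
import Literature.Geometry.Lorentzian.ChartLaplacian
import Mathlib.Analysis.Calculus.Gradient.Basic
import HarnessLib

/-!
# The round cap factor `ψ_K = θ_K ∘ G` of the Green-function blow-up
(stub S3 `stub_capFactorRound` of line `green-blowup-conformal-entropy`, crux
`EntropyRung.SubcylindricalExistence`, item stmt-SmoothPoincare4-10871, lead c2)

For a smooth Riemannian metric `g` (Levi-Civita) with `R_g ≥ 0` on a 4-manifold of the summit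
binder, Green data `(p, G)` (`G` smooth and positive off `p`, `R G − 6 Δ_g G = 0` off `p`) in
Schoen's flat gauge at `p` (`φ = extChartAt p`, `y₀ = φ p`: `B̄(y₀, r) ⊆ φ.target`, `φ⁻¹` a
`g`-isometry there, `G ∘ φ⁻¹ = a/‖· − y₀‖²` on the punctured ball, `R_g = 0` only on that ball), and
assuming the flat-chart gradient identity S0 (`|∇f|²_g(φ⁻¹ y) = ‖∇(f ∘ φ⁻¹)(y)‖²`), the function
`ψ_K = 4KG/(4K + G)` off `p`, `ψ_K(p) = 4K` (`K > 0`), is smooth, positive, and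
`L_g ψ_K = R ψ_K − 6 Δ_g ψ_K > 0` everywhere. Off `p`, `ψ_K = θ_K ∘ G` with the Möbius profile
`θ_K(s) = 4Ks/(4K+s)`; the chain rule for `Δ_g` (`dalembertian_real_comp`) and `6 Δ_g G = R G` give
`L_g ψ_K = R · 4KG²/(4K+G)² + 192K² |∇G|²_g/(4K+G)³ ≥ 0`, `> 0` where `R > 0`, and on the flat ball
`|∇G|²_g = 4a²/‖y − y₀‖⁶` (S0, Euclidean gradient of `a/‖y − y₀‖²`, valid up to the boundary of
the closed ball by unique differentiability on convex sets) gives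
`L_g ψ_K ≥ 768K²a²/(4Kr² + a)³ > 0`. At `p`, `ψ_K ∘ φ⁻¹ = 4Ka/(4K‖y−y₀‖²+a)` is smooth through
`y₀`, and the same bound holds by continuity of `L_g ψ_K` (`continuous_dalembertian`) along the
chart ray `t ↦ φ⁻¹(y₀ + t e₀)`. References: Schoen 1984; Lee–Parker 1987, §2 (the conformal
Laplacian `−6Δ_g + R_g` in dimension 4) and §6 (the Green-function blow-up).
-/

noncomputable section

-- the registered namespace `Summit.SmoothPoincare4.SmoothPoincare4.Theorems` repeats a component
set_option linter.dupNamespace false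

open scoped Manifold ContDiff Topology RealInnerProductSpace
open Set Filter
open Literature.Geometry.Lorentzian Literature.Geometry.Riemannian

namespace Summit.SmoothPoincare4.SmoothPoincare4.Theorems

namespace CapFactorRound

/-! ### The Möbius profile `θ_K(s) = 4Ks/(4K+s)` and the Euclidean model `a/‖z - y₀‖²` -/

/-- `θ_K'(s) = 16K²/(4K+s)²` away from `s = -4K`. -/
theorem hasDerivAt_moebius (K : ℝ) {s : ℝ} (hs : 4 * K + s ≠ 0) :
    HasDerivAt (fun s : ℝ ↦ 4 * K * s / (4 * K + s)) (16 * K ^ 2 / (4 * K + s) ^ 2) s := by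
  refine (((hasDerivAt_id' s).const_mul (4 * K)).fun_div
    ((hasDerivAt_id' s).const_add (4 * K)) hs).congr_deriv ?_
  field_simp
  ring

/-- `θ_K''(s) = -32K²/(4K+s)³` for `s > -4K`. -/
theorem deriv_deriv_moebius (K : ℝ) {s : ℝ} (hs : -(4 * K) < s) :
    deriv (deriv (fun s : ℝ ↦ 4 * K * s / (4 * K + s))) s = -(32 * K ^ 2) / (4 * K + s) ^ 3 := by
  have hev : deriv (fun s : ℝ ↦ 4 * K * s / (4 * K + s)) =ᶠ[𝓝 s]
      fun s ↦ 16 * K ^ 2 / (4 * K + s) ^ 2 := by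
    filter_upwards [Ioi_mem_nhds hs] with t ht
    exact (hasDerivAt_moebius K (by simp only [mem_Ioi] at ht; linarith)).deriv
  have hne : 4 * K + s ≠ 0 := by linarith
  rw [hev.deriv_eq]
  refine (((hasDerivAt_const s (16 * K ^ 2)).fun_div (((hasDerivAt_id' s).const_add
    (4 * K)).fun_pow 2) (pow_ne_zero 2 hne)).congr_deriv ?_).deriv
  field_simp
  ring

/-- `θ_K` is smooth away from `s = -4K`. -/
theorem contDiffAt_moebius (K : ℝ) {n : WithTop ℕ∞} {s : ℝ} (hs : 4 * K + s ≠ 0) :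
    ContDiffAt ℝ n (fun s : ℝ ↦ 4 * K * s / (4 * K + s)) s :=
  (contDiffAt_const.mul contDiffAt_id).div (contDiffAt_const.add contDiffAt_id) hs

section Model

variable {E : Type*} [NormedAddCommGroup E] [InnerProductSpace ℝ E]

/-- The gradient of `z ↦ a/‖z - y₀‖²` at `y ≠ y₀` is `-(2a/‖y - y₀‖⁴) (y - y₀)`. -/
theorem hasGradientAt_model [CompleteSpace E] (a : ℝ) {y y₀ : E} (hy : y ≠ y₀) :
    HasGradientAt (fun z : E ↦ a / ‖z - y₀‖ ^ 2)
      ((-(2 * a) / (‖y - y₀‖ ^ 2) ^ 2) • (y - y₀)) y := by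
  have hd : ‖y - y₀‖ ^ 2 ≠ 0 := pow_ne_zero 2 (norm_pos_iff.mpr (sub_ne_zero.mpr hy)).ne'
  have h1 : HasFDerivAt (fun z : E ↦ ‖z - y₀‖ ^ 2)
      (2 • (innerSL ℝ (y - y₀)).comp (ContinuousLinearMap.id ℝ E)) y :=
    ((hasFDerivAt_id y).sub_const y₀).norm_sq
  have h2 : HasDerivAt (fun t : ℝ ↦ a / t) (-a / (‖y - y₀‖ ^ 2) ^ 2) (‖y - y₀‖ ^ 2) := by
    refine ((hasDerivAt_const _ a).fun_div (hasDerivAt_id' (‖y - y₀‖ ^ 2)) hd).congr_deriv ?_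
    ring
  rw [hasGradientAt_iff_hasFDerivAt]
  refine (h2.comp_hasFDerivAt y h1).congr_fderiv ?_
  ext z
  simp only [FunLike.coe_smul, Pi.smul_apply, ContinuousLinearMap.comp_apply,
    ContinuousLinearMap.id_apply, innerSL_apply_apply, InnerProductSpace.toDual_apply_apply,
    real_inner_smul_left, smul_eq_mul]
  simp only [nsmul_eq_mul, Nat.cast_ofNat]
  ring

/-- `‖-(2a/‖y - y₀‖⁴) (y - y₀)‖² = 4a²/‖y - y₀‖⁶`. -/
theorem norm_model_gradient_sq (a : ℝ) {y y₀ : E} (hy : y ≠ y₀) :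
    ‖(-(2 * a) / (‖y - y₀‖ ^ 2) ^ 2) • (y - y₀)‖ ^ 2 = 4 * a ^ 2 / (‖y - y₀‖ ^ 2) ^ 3 := by
  have hd : ‖y - y₀‖ ≠ 0 := (norm_pos_iff.mpr (sub_ne_zero.mpr hy)).ne'
  rw [norm_smul, mul_pow, Real.norm_eq_abs, sq_abs]
  field_simp
  ring

end Model

/-! ### The flat chart and the cap factor off the pole -/

section OffPole

open scoped Classical

variable {M : Type*} [TopologicalSpace M] [ChartedSpace (EuclideanSpace ℝ (Fin 4)) M]
  [IsManifold (𝓡 4) ∞ M]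
  (g : PseudoRiemannianMetric (𝓡 4) ∞ (EuclideanSpace ℝ (Fin 4)) (TangentSpace (𝓡 4) : M → Type _))
  {p : M} {G : M → ℝ} {K a r : ℝ} {y : EuclideanSpace ℝ (Fin 4)}

omit [IsManifold (𝓡 4) ∞ M] in
/-- Points of the chart target other than `φ p` are sent off the pole by `φ⁻¹`. -/
theorem extChartAt_symm_ne_pole (hyT : y ∈ (extChartAt (𝓡 4) p).target)
    (hy : y ≠ extChartAt (𝓡 4) p p) : (extChartAt (𝓡 4) p).symm y ≠ p :=
  fun h ↦ hy (by rw [← (extChartAt (𝓡 4) p).right_inv hyT, h])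

omit [IsManifold (𝓡 4) ∞ M] in
/-- Points of the chart source other than `p` are charted off `φ p`. -/
theorem extChartAt_ne_pole {x : M} (hxs : x ∈ (extChartAt (𝓡 4) p).source) (hx : x ≠ p) :
    extChartAt (𝓡 4) p x ≠ extChartAt (𝓡 4) p p :=
  fun h ↦ hx (by rw [← (extChartAt (𝓡 4) p).left_inv hxs, h, extChartAt_to_inv])

omit [IsManifold (𝓡 4) ∞ M] in
/-- `G` is smooth at every point other than the pole. -/
theorem contMDiffAt_green [T1Space M] (hGs : ContMDiffOn (𝓡 4) 𝓘(ℝ, ℝ) ∞ G {p}ᶜ) {x : M}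
    (hx : x ≠ p) : ContMDiffAt (𝓡 4) 𝓘(ℝ, ℝ) ∞ G x :=
  (hGs x (by simpa using hx)).contMDiffAt (isOpen_compl_singleton.mem_nhds (by simpa using hx))

/-- **The Euclidean gradient of `G ∘ φ⁻¹` on the punctured closed flat ball**, boundary included:
it is the gradient `-(2a/‖y - y₀‖⁴)(y - y₀)` of the model `a/‖· - y₀‖²`, with which `G ∘ φ⁻¹`
agrees on the punctured closed ball — a convex set of unique differentiability. -/
theorem gradient_green_comp_symm [T1Space M] (hGs : ContMDiffOn (𝓡 4) 𝓘(ℝ, ℝ) ∞ G {p}ᶜ)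
    (hr : 0 < r) (hsub : Metric.closedBall (extChartAt (𝓡 4) p p) r ⊆ (extChartAt (𝓡 4) p).target)
    (hGeq : ∀ y ∈ Metric.closedBall (extChartAt (𝓡 4) p p) r, y ≠ extChartAt (𝓡 4) p p →
      G ((extChartAt (𝓡 4) p).symm y) = a / ‖y - extChartAt (𝓡 4) p p‖ ^ 2)
    (hy : y ∈ Metric.closedBall (extChartAt (𝓡 4) p p) r) (hne : y ≠ extChartAt (𝓡 4) p p) :
    gradient (G ∘ (extChartAt (𝓡 4) p).symm) y =
      (-(2 * a) / (‖y - extChartAt (𝓡 4) p p‖ ^ 2) ^ 2) • (y - extChartAt (𝓡 4) p p) := by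
  have h1 : DifferentiableAt ℝ (G ∘ (extChartAt (𝓡 4) p).symm) y := by
    have hs : ContMDiffAt 𝓘(ℝ, EuclideanSpace ℝ (Fin 4)) (𝓡 4) ∞ (extChartAt (𝓡 4) p).symm y :=
      (contMDiffOn_extChartAt_symm p y (hsub hy)).contMDiffAt
        ((isOpen_extChartAt_target p).mem_nhds (hsub hy))
    exact (contMDiffAt_iff_contDiffAt.mp ((contMDiffAt_green hGs
      (extChartAt_symm_ne_pole (hsub hy) hne)).comp y hs)).differentiableAt (by simp)
  have h2 := hasGradientAt_model a hne
  have hU : UniqueDiffWithinAt ℝ (Metric.closedBall (extChartAt (𝓡 4) p p) r) y :=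
    uniqueDiffWithinAt_convex (convex_closedBall _ _)
      ⟨extChartAt (𝓡 4) p p, Metric.ball_subset_interior_closedBall (Metric.mem_ball_self hr)⟩
      (subset_closure hy)
  have hev : (G ∘ (extChartAt (𝓡 4) p).symm) =ᶠ[𝓝[Metric.closedBall (extChartAt (𝓡 4) p p) r] y]
      fun z ↦ a / ‖z - extChartAt (𝓡 4) p p‖ ^ 2 := by
    rw [EventuallyEq, eventually_nhdsWithin_iff]
    filter_upwards [isOpen_compl_singleton.mem_nhds
      (show y ∈ ({extChartAt (𝓡 4) p p}ᶜ : Set _) by simpa using hne)] with z hz hzs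
    exact hGeq z hzs (by simpa using hz)
  rw [← h2.gradient, gradient, gradient, ← h1.fderivWithin hU,
    ← h2.differentiableAt.fderivWithin hU, hev.fderivWithin_eq (hGeq y hy hne)]

omit [ChartedSpace (EuclideanSpace ℝ (Fin 4)) M] [IsManifold (𝓡 4) ∞ M] in
/-- Off the pole, `ψ_K` agrees with `θ_K ∘ G` near every point. -/
theorem psi_eventuallyEq_comp [T1Space M] {x : M} (hx : x ≠ p) :
    (fun x : M ↦ if x = p then 4 * K else 4 * K * G x / (4 * K + G x)) =ᶠ[𝓝 x]
      ((fun s : ℝ ↦ 4 * K * s / (4 * K + s)) ∘ G) := by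
  filter_upwards [isOpen_compl_singleton.mem_nhds (show x ∈ ({p}ᶜ : Set M) by simpa using hx)]
    with y hy
  have hyp : y ≠ p := by simpa using hy
  simp [hyp]

omit [IsManifold (𝓡 4) ∞ M] in
/-- Near the pole, `ψ_K = F ∘ φ` with the smooth Euclidean profile `F(z) = 4Ka/(4K‖z − y₀‖² + a)`
(`G ∘ φ⁻¹ = a/‖· − y₀‖²` on the flat ball; value `4K` at `y₀`). -/
theorem psi_eventuallyEq_pole (ha : 0 < a) (hr : 0 < r)
    (hGeq : ∀ y ∈ Metric.closedBall (extChartAt (𝓡 4) p p) r, y ≠ extChartAt (𝓡 4) p p →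
      G ((extChartAt (𝓡 4) p).symm y) = a / ‖y - extChartAt (𝓡 4) p p‖ ^ 2) :
    (fun x : M ↦ if x = p then 4 * K else 4 * K * G x / (4 * K + G x)) =ᶠ[𝓝 p]
      ((fun z : EuclideanSpace ℝ (Fin 4) ↦
          4 * K * a / (4 * K * ‖z - extChartAt (𝓡 4) p p‖ ^ 2 + a)) ∘ extChartAt (𝓡 4) p) := by
  filter_upwards [extChartAt_source_mem_nhds (I := 𝓡 4) p,
    (continuousAt_extChartAt (I := 𝓡 4) p).preimage_mem_nhds
      (Metric.closedBall_mem_nhds _ hr)] with x hxs hxb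
  by_cases hx : x = p
  · subst hx
    rw [if_pos rfl, Function.comp_apply, sub_self, norm_zero, sq, mul_zero, mul_zero, zero_add,
      mul_div_assoc, div_self ha.ne', mul_one]
  · have hne : extChartAt (𝓡 4) p x ≠ extChartAt (𝓡 4) p p := extChartAt_ne_pole hxs hx
    have hGx : G x = a / ‖extChartAt (𝓡 4) p x - extChartAt (𝓡 4) p p‖ ^ 2 := by
      have := hGeq (extChartAt (𝓡 4) p x) hxb hne
      rwa [(extChartAt (𝓡 4) p).left_inv hxs] at this
    have hd : ‖extChartAt (𝓡 4) p x - extChartAt (𝓡 4) p p‖ ≠ 0 :=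
      (norm_pos_iff.mpr (sub_ne_zero.mpr hne)).ne'
    simp only [if_neg hx, Function.comp_apply, hGx]
    field_simp

omit [IsManifold (𝓡 4) ∞ M] in
/-- **`ψ_K` is smooth**: off `p` it is `θ_K ∘ G` (`θ_K` smooth on `s > -4K`, `G > 0`), near `p` it
is `F ∘ φ` with `F` smooth on all of `ℝ⁴`. -/
theorem psi_contMDiff [T1Space M] (hK : 0 < K) (ha : 0 < a) (hr : 0 < r)
    (hGs : ContMDiffOn (𝓡 4) 𝓘(ℝ, ℝ) ∞ G {p}ᶜ) (hGpos : ∀ x, x ≠ p → 0 < G x)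
    (hGeq : ∀ y ∈ Metric.closedBall (extChartAt (𝓡 4) p p) r, y ≠ extChartAt (𝓡 4) p p →
      G ((extChartAt (𝓡 4) p).symm y) = a / ‖y - extChartAt (𝓡 4) p p‖ ^ 2) :
    ContMDiff (𝓡 4) 𝓘(ℝ, ℝ) ∞
      (fun x : M ↦ if x = p then 4 * K else 4 * K * G x / (4 * K + G x)) := by
  intro x
  by_cases hx : x = p
  · subst hx
    have hF : ContDiff ℝ ∞ (fun z : EuclideanSpace ℝ (Fin 4) ↦
        4 * K * a / (4 * K * ‖z - extChartAt (𝓡 4) x x‖ ^ 2 + a)) :=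
      contDiff_const.div
        ((contDiff_const.mul ((contDiff_id.sub contDiff_const).norm_sq ℝ)).add contDiff_const)
        (fun z ↦ by positivity)
    exact (hF.contDiffAt.comp_contMDiffAt contMDiffAt_extChartAt).congr_of_eventuallyEq
      (psi_eventuallyEq_pole ha hr hGeq)
  · exact ((contDiffAt_moebius K (by linarith [hGpos x hx])).comp_contMDiffAt
      (contMDiffAt_green hGs hx)).congr_of_eventuallyEq (psi_eventuallyEq_comp hx)

variable [g.HasLeviCivita]

/-- **The conformal Laplacian of `ψ_K` off the pole**:
`R ψ_K − 6 Δ_g ψ_K = R · 4KG²/(4K+G)² + 192K² |∇G|²_g/(4K+G)³` (chain rule for `Δ_g` and the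
Green equation `6 Δ_g G = R G`). -/
theorem conformalLaplacian_psi_eq [T1Space M] (hK : 0 < K)
    (hGs : ContMDiffOn (𝓡 4) 𝓘(ℝ, ℝ) ∞ G {p}ᶜ) (hGpos : ∀ x, x ≠ p → 0 < G x)
    (hGreen : ∀ x, x ≠ p → g.scalarCurvature x * G x - 6 * g.dalembertian G x = 0)
    {x : M} (hx : x ≠ p) :
    g.scalarCurvature x * (if x = p then 4 * K else 4 * K * G x / (4 * K + G x))
        - 6 * g.dalembertian (fun y : M ↦ if y = p then 4 * K else 4 * K * G y / (4 * K + G y)) x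
      = g.scalarCurvature x * (4 * K * G x ^ 2 / (4 * K + G x) ^ 2)
        + 192 * K ^ 2 / (4 * K + G x) ^ 3 * g.gradSq G x := by
  have hGx := hGpos x hx
  have hG2 : ContMDiffAt (𝓡 4) 𝓘(ℝ, ℝ) 2 G x :=
    (contMDiffAt_green hGs hx).of_le (WithTop.coe_le_coe.mpr le_top)
  have hne : 4 * K + G x ≠ 0 := by linarith
  rw [g.dalembertian_congr_of_eventuallyEq (psi_eventuallyEq_comp hx), if_neg hx,
    g.dalembertian_real_comp hG2 (contDiffAt_moebius K hne), (hasDerivAt_moebius K hne).deriv,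
    deriv_deriv_moebius K (by linarith)]
  have hΔG : g.dalembertian G x = g.scalarCurvature x * G x / 6 := by linarith [hGreen x hx]
  have hgs : g.innerDual x (mvfderiv (𝓡 4) G x).toLinearMap (mvfderiv (𝓡 4) G x).toLinearMap
      = g.gradSq G x := rfl
  rw [hΔG, hgs]
  field_simp
  ring

/-- **The uniform lower bound on the flat ball**: for `y` in the punctured closed flat ball (where
S0 holds), `L_g ψ_K (φ⁻¹ y) ≥ 768K²a²/(4Kr² + a)³` (`R ≥ 0`, `G = a/‖y−y₀‖²`,
`|∇G|²_g = 4a²/‖y−y₀‖⁶`). -/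
theorem conformalLaplacian_psi_ge [T1Space M] (hK : 0 < K) (ha : 0 < a)
    (hR : ∀ x, 0 ≤ g.scalarCurvature x)
    (hGs : ContMDiffOn (𝓡 4) 𝓘(ℝ, ℝ) ∞ G {p}ᶜ) (hGpos : ∀ x, x ≠ p → 0 < G x)
    (hGreen : ∀ x, x ≠ p → g.scalarCurvature x * G x - 6 * g.dalembertian G x = 0) (hr : 0 < r)
    (hsub : Metric.closedBall (extChartAt (𝓡 4) p p) r ⊆ (extChartAt (𝓡 4) p).target)
    (hGeq : ∀ y ∈ Metric.closedBall (extChartAt (𝓡 4) p p) r, y ≠ extChartAt (𝓡 4) p p →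
      G ((extChartAt (𝓡 4) p).symm y) = a / ‖y - extChartAt (𝓡 4) p p‖ ^ 2)
    (hy : y ∈ Metric.closedBall (extChartAt (𝓡 4) p p) r) (hne : y ≠ extChartAt (𝓡 4) p p)
    (hS0y : ∀ f : M → ℝ, MDifferentiableAt (𝓡 4) 𝓘(ℝ, ℝ) f ((extChartAt (𝓡 4) p).symm y) →
      g.gradSq f ((extChartAt (𝓡 4) p).symm y)
        = ‖gradient (f ∘ (extChartAt (𝓡 4) p).symm) y‖ ^ 2) :
    768 * K ^ 2 * a ^ 2 / (4 * K * r ^ 2 + a) ^ 3 ≤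
      g.scalarCurvature ((extChartAt (𝓡 4) p).symm y)
          * (if (extChartAt (𝓡 4) p).symm y = p then 4 * K else
              4 * K * G ((extChartAt (𝓡 4) p).symm y) / (4 * K + G ((extChartAt (𝓡 4) p).symm y)))
        - 6 * g.dalembertian (fun x : M ↦ if x = p then 4 * K else 4 * K * G x / (4 * K + G x))
          ((extChartAt (𝓡 4) p).symm y) := by
  have hx : (extChartAt (𝓡 4) p).symm y ≠ p := extChartAt_symm_ne_pole (hsub hy) hne
  have hgrad : g.gradSq G ((extChartAt (𝓡 4) p).symm y)
      = 4 * a ^ 2 / (‖y - extChartAt (𝓡 4) p p‖ ^ 2) ^ 3 := by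
    rw [hS0y G ((contMDiffAt_green hGs hx).mdifferentiableAt (by simp)),
      gradient_green_comp_symm hGs hr hsub hGeq hy hne, norm_model_gradient_sq a hne]
  rw [conformalLaplacian_psi_eq g hK hGs hGpos hGreen hx, hgrad, hGeq y hy hne]
  have hd : 0 < ‖y - extChartAt (𝓡 4) p p‖ := norm_pos_iff.mpr (sub_ne_zero.mpr hne)
  set D := ‖y - extChartAt (𝓡 4) p p‖ ^ 2 with hD
  have hDpos : 0 < D := by positivity
  have hDr : D ≤ r ^ 2 := pow_le_pow_left₀ (norm_nonneg _) (mem_closedBall_iff_norm.1 hy) 2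
  have hA : 0 ≤ g.scalarCurvature ((extChartAt (𝓡 4) p).symm y)
      * (4 * K * (a / D) ^ 2 / (4 * K + a / D) ^ 2) := mul_nonneg (hR _) (by positivity)
  have hB : 192 * K ^ 2 / (4 * K + a / D) ^ 3 * (4 * a ^ 2 / D ^ 3)
      = 768 * K ^ 2 * a ^ 2 / (4 * K * D + a) ^ 3 := by
    field_simp
    ring
  have hC : 768 * K ^ 2 * a ^ 2 / (4 * K * r ^ 2 + a) ^ 3
      ≤ 768 * K ^ 2 * a ^ 2 / (4 * K * D + a) ^ 3 :=
    div_le_div_of_nonneg_left (by positivity) (by positivity)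
      (pow_le_pow_left₀ (by positivity) (by nlinarith) 3)
  linarith [hA, hB, hC]

/-- **Lower bounds on the punctured flat ball pass to the pole**: if `ψ` is `C^∞` and
`c ≤ L_g ψ (φ⁻¹ y)` for all `y` in the punctured closed flat ball, then `c ≤ L_g ψ (p)` —
`L_g ψ = R ψ − 6 Δ_g ψ` is continuous (`continuous_dalembertian`, `contMDiff_scalarCurvature`) and
`p` is the limit of the chart ray `t ↦ φ⁻¹(y₀ + t e₀)`, `t → 0⁺`. -/
theorem le_conformalLaplacian_pole {ψ : M → ℝ} (hψ : ContMDiff (𝓡 4) 𝓘(ℝ, ℝ) ∞ ψ) (hr : 0 < r)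
    {c : ℝ} (hbound : ∀ y ∈ Metric.closedBall (extChartAt (𝓡 4) p p) r, y ≠ extChartAt (𝓡 4) p p →
      c ≤ g.scalarCurvature ((extChartAt (𝓡 4) p).symm y) * ψ ((extChartAt (𝓡 4) p).symm y)
        - 6 * g.dalembertian ψ ((extChartAt (𝓡 4) p).symm y)) :
    c ≤ g.scalarCurvature p * ψ p - 6 * g.dalembertian ψ p := by
  have hcont : Continuous (fun x ↦ g.scalarCurvature x * ψ x - 6 * g.dalembertian ψ x) :=
    (g.contMDiff_scalarCurvature.continuous.mul hψ.continuous).sub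
      (continuous_const.mul (continuous_dalembertian g (hψ.of_le (WithTop.coe_le_coe.mpr le_top))))
  set e : EuclideanSpace ℝ (Fin 4) := EuclideanSpace.single (0 : Fin 4) (1 : ℝ) with he_def
  have he : ‖e‖ = 1 := by simp [he_def]
  have hγ : Tendsto (fun t : ℝ ↦ (extChartAt (𝓡 4) p).symm (extChartAt (𝓡 4) p p + t • e))
      (𝓝[>] 0) (𝓝 p) := by
    have h1 : Tendsto (fun t : ℝ ↦ extChartAt (𝓡 4) p p + t • e) (𝓝 0)
        (𝓝 (extChartAt (𝓡 4) p p)) := by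
      have hc : Continuous (fun t : ℝ ↦ extChartAt (𝓡 4) p p + t • e) := by fun_prop
      simpa using hc.tendsto 0
    have h2 := (continuousAt_extChartAt_symm (I := 𝓡 4) p).tendsto.comp h1
    rw [extChartAt_to_inv] at h2
    exact tendsto_nhdsWithin_of_tendsto_nhds h2
  refine ge_of_tendsto (hcont.continuousAt.tendsto.comp hγ) ?_
  filter_upwards [Ioc_mem_nhdsGT hr] with t ht
  have hnorm : ‖extChartAt (𝓡 4) p p + t • e - extChartAt (𝓡 4) p p‖ = t := by
    rw [add_sub_cancel_left, norm_smul, he, mul_one, Real.norm_eq_abs, abs_of_pos ht.1]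
  exact hbound _ (mem_closedBall_iff_norm.2 (hnorm.le.trans ht.2))
    (fun h ↦ ht.1.ne' (by rw [← hnorm, h, sub_self, norm_zero]))

end OffPole

end CapFactorRound

/-- **Stub S3 `stub_capFactorRound` — the round cap factor `ψ_K = θ_K ∘ G`** (line
`green-blowup-conformal-entropy`, crux stmt-SmoothPoincare4-10871). Flat gauge at `p`, Green data,
`R_g ≥ 0` vanishing only on the flat ball; assume the flat-chart gradient identity S0 (by text).
For `K > 0` the function `ψ_K := 4KG/(4K+G)` off `p`, `ψ_K(p) := 4K`, is smooth, positive, and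
`L_g ψ_K = R_g ψ_K − 6Δ_g ψ_K > 0` everywhere: off `p`,
`L_g ψ_K = R · 4KG²/(4K+G)² + 192K²|∇G|²_g/(4K+G)³`, positive where `R > 0` and, on the flat ball,
because `|∇G|²_g = 4a²/‖y−y₀‖⁶ > 0` (S0); at `p` by continuity from the explicit lower bound
`768K²a²/(4Kr²+a)³` on the punctured ball. Schoen 1984; Lee–Parker 1987, §2 and §6. [folklore] -/
theorem stub_capFactorRound :
    (∀ (M : Type) [TopologicalSpace M] [T2Space M] [SecondCountableTopology M]
      [ChartedSpace (EuclideanSpace ℝ (Fin 4)) M] [IsManifold (𝓡 4) ∞ M] [CompactSpace M]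
      [T3Space M] [MeasurableSpace M] [BorelSpace M]
      (g : PseudoRiemannianMetric (𝓡 4) ∞ (EuclideanSpace ℝ (Fin 4)) (TangentSpace (𝓡 4) : M → Type _))
      (p : M) (y : EuclideanSpace ℝ (Fin 4)), y ∈ (extChartAt (𝓡 4) p).target →
      (∀ X W : EuclideanSpace ℝ (Fin 4),
        g.val ((extChartAt (𝓡 4) p).symm y)
          (mfderiv 𝓘(ℝ, EuclideanSpace ℝ (Fin 4)) (𝓡 4) (extChartAt (𝓡 4) p).symm y X)
          (mfderiv 𝓘(ℝ, EuclideanSpace ℝ (Fin 4)) (𝓡 4) (extChartAt (𝓡 4) p).symm y W) = ⟪X, W⟫) →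
      ∀ f : M → ℝ, MDifferentiableAt (𝓡 4) 𝓘(ℝ, ℝ) f ((extChartAt (𝓡 4) p).symm y) →
        g.gradSq f ((extChartAt (𝓡 4) p).symm y) = ‖gradient (f ∘ (extChartAt (𝓡 4) p).symm) y‖ ^ 2) →
    ∀ (M : Type) [TopologicalSpace M] [T2Space M] [SecondCountableTopology M]
      [ChartedSpace (EuclideanSpace ℝ (Fin 4)) M] [IsManifold (𝓡 4) ∞ M] [CompactSpace M]
      [T3Space M] [MeasurableSpace M] [BorelSpace M]
      (g : PseudoRiemannianMetric (𝓡 4) ∞ (EuclideanSpace ℝ (Fin 4)) (TangentSpace (𝓡 4) : M → Type _))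
      [g.HasLeviCivita], g.IsRiemannian → (∀ x, 0 ≤ g.scalarCurvature x) →
      ∀ (p : M) (G : M → ℝ),
        (ContMDiffOn (𝓡 4) 𝓘(ℝ, ℝ) ∞ G {p}ᶜ ∧ (∀ x, x ≠ p → 0 < G x) ∧
          (∀ x, x ≠ p → g.scalarCurvature x * G x - 6 * g.dalembertian G x = 0) ∧
          Tendsto G (𝓝[≠] p) atTop) →
      ∀ (a r : ℝ), 0 < a → 0 < r →
        Metric.closedBall (extChartAt (𝓡 4) p p) r ⊆ (extChartAt (𝓡 4) p).target →
        (∀ y ∈ Metric.closedBall (extChartAt (𝓡 4) p p) r, ∀ X W : EuclideanSpace ℝ (Fin 4),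
          g.val ((extChartAt (𝓡 4) p).symm y)
            (mfderiv 𝓘(ℝ, EuclideanSpace ℝ (Fin 4)) (𝓡 4) (extChartAt (𝓡 4) p).symm y X)
            (mfderiv 𝓘(ℝ, EuclideanSpace ℝ (Fin 4)) (𝓡 4) (extChartAt (𝓡 4) p).symm y W) = ⟪X, W⟫) →
        (∀ y ∈ Metric.closedBall (extChartAt (𝓡 4) p p) r, y ≠ extChartAt (𝓡 4) p p →
          G ((extChartAt (𝓡 4) p).symm y) = a / ‖y - extChartAt (𝓡 4) p p‖ ^ 2) →
        (∀ x, g.scalarCurvature x = 0 → x ∈ (extChartAt (𝓡 4) p).source ∧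
          extChartAt (𝓡 4) p x ∈ Metric.closedBall (extChartAt (𝓡 4) p p) r) →
      ∀ (K : ℝ), 0 < K →
        ∃ ψ : M → ℝ, ContMDiff (𝓡 4) 𝓘(ℝ, ℝ) ∞ ψ ∧ (∀ x, 0 < ψ x) ∧
          (∀ x, 0 < g.scalarCurvature x * ψ x - 6 * g.dalembertian ψ x) ∧
          (∀ x, x ≠ p → ψ x = 4 * K * G x / (4 * K + G x)) ∧ ψ p = 4 * K := by
  classical
  intro hS0 M _ _ _ _ _ _ _ _ _ g _ hg hR p G hGreen a r ha hr hsub hflat hGeq hRzero K hK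
  obtain ⟨hGs, hGpos, hGeqn, -⟩ := hGreen
  have hψ := CapFactorRound.psi_contMDiff (K := K) hK ha hr hGs hGpos hGeq
  have hflatBound := fun y hy hne ↦ CapFactorRound.conformalLaplacian_psi_ge g hK ha hR hGs hGpos
    hGeqn hr hsub hGeq hy hne (hS0 M g p y (hsub hy) (hflat y hy))
  have hc : 0 < 768 * K ^ 2 * a ^ 2 / (4 * K * r ^ 2 + a) ^ 3 := by positivity
  refine ⟨_, hψ, fun x ↦ ?_, fun x ↦ ?_, fun x hx ↦ by simp [hx], by simp⟩
  · by_cases hx : x = p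
    · rw [if_pos hx]; positivity
    · rw [if_neg hx]; have := hGpos x hx; positivity
  · by_cases hx : x = p
    · subst hx
      exact hc.trans_le (CapFactorRound.le_conformalLaplacian_pole g hψ hr hflatBound)
    · rcases (hR x).eq_or_lt with h0 | hpos
      · obtain ⟨hxs, hxb⟩ := hRzero x h0.symm  -- `R x = 0`: `x` lies on the flat ball
        have key := hflatBound _ hxb (CapFactorRound.extChartAt_ne_pole hxs hx)
        rw [(extChartAt (𝓡 4) p).left_inv hxs] at key
        exact hc.trans_le key
      · rw [CapFactorRound.conformalLaplacian_psi_eq g hK hGs hGpos hGeqn hx]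
        have hGx := hGpos x hx
        have h1 : 0 < g.scalarCurvature x * (4 * K * G x ^ 2 / (4 * K + G x) ^ 2) :=
          mul_pos hpos (by positivity)
        have h2 : 0 ≤ 192 * K ^ 2 / (4 * K + G x) ^ 3 * g.gradSq G x :=
          mul_nonneg (by positivity) (g.gradSq_nonneg hg G x)
        linarith

end Summit.SmoothPoincare4.SmoothPoincare4.Theorems

end
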